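import Mathlib
import HarnessLib
import Literature.MathematicalPhysics.KineticTheory.HardSphereEulerProofs
import Literature.Analysis.FluidPDE.HardSphereMomentumConservation
import Literature.MathematicalPhysics.KineticTheory.HardSphereBBGKYLiouvilleFlow

/-!
# Crux `MeanSecondLaw` (stmt-AtomisticToContinuum-9257), line `registered` — stub `stub_conservedTotalsInLaw`

Support file for the crux
`Summit.AtomisticToContinuum.HydrodynamicLimit.Theses.AnnealedZeroHorizon.MeanSecondLaw`
(route `AnnealedZeroHorizon`, sub-problem `HydrodynamicLimit`), birth skeleton, registered stub
`stub_conservedTotalsInLaw` (DYNAMIC input, conservation laws).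

Statement: for the local Gibbs law `P₀ = localGibbsLaw σ a₀ u₀ θ₀ N Φ` of `N + 1` hard spheres
(`= localGibbsMeasure σ a₀ u₀ θ₀ N`, `localGibbsLaw_eq`) and every time `t`, the joint law of the
totals `(⟨m_N, 1⟩, ⟨E_N, 1⟩) = ((N+1)⁻¹ ∑ᵢ vᵢ, (N+1)⁻¹ ∑ᵢ ‖vᵢ‖²/2)` (total momentum and total
kinetic energy per particle, `empiricalMomentumField z 1`, `empiricalEnergyField z 1`) under the
time-`t` law `(Φ_t)_* P₀` equals the joint law under `P₀`.

Proof (pure bookkeeping over landed facts):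

* the totals are `(N+1)⁻¹ • configMomentum z` and `(N+1)⁻¹ * configEnergy z`
  (`empiricalMomentumField_eq_sum`, `empiricalEnergyField_eq_sum`), hence measurable functions
  of the configuration, so the event `{z | (m z, E z) ∈ B}` is measurable and
  `Measure.map_apply` computes the push-forward as the measure of the preimage under `Φ_t`;
* on the good set `Φ.good` the total momentum and the kinetic energy are conserved along the
  flow (`HardSphereFlow.configMomentum_flow`, `HardSphereFlow.configEnergy_flow`), so the
  preimage and the event agree there;
* the good set is conull for `P₀` (`localGibbsMeasure_absolutelyContinuous` and
  `HardSphereFlow.ae_mem_good`), whence `measure_congr`.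

The hypotheses `0 < σ`, continuity / positivity of the profiles and `0 ≤ t` of the registered
signature are not used.

References: I. Gallagher, L. Saint-Raymond, B. Texier, *From Newton to Boltzmann* (2013), §1.1,
Prop. 4.1.1 (conservation laws, Alexander's flow); H. Spohn, *Large Scale Dynamics of Interacting
Particles* (1991), Part I §2.3 (local Gibbs states).
-/

noncomputable section

namespace Summit.AtomisticToContinuum.HydrodynamicLimit.Theorems.MeanSecondLawBirth

open MeasureTheory Filter Set Topology
open scoped ENNReal
open Literature.MathematicalPhysics.KineticTheory

/-! ## The totals as functions of the configuration -/

/-- The total momentum per particle is `N⁻¹ • configMomentum`: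
`empiricalMomentumField z 1 = N⁻¹ • ∑ᵢ vᵢ`. -/
private theorem empiricalMomentumField_one_eq {N : ℕ}
    (z : Literature.Analysis.FluidPDE.Config N (Fin 3) T3) :
    empiricalMomentumField z (fun _ => 1) =
      (N : ℝ)⁻¹ • Literature.Analysis.FluidPDE.configMomentum z := by
  rw [empiricalMomentumField_eq_sum, Literature.Analysis.FluidPDE.configMomentum]
  simp only [one_smul]

/-- The total kinetic energy per particle is `N⁻¹ * configEnergy`:
`empiricalEnergyField z 1 = N⁻¹ * (2⁻¹ ∑ᵢ ‖vᵢ‖²)`. -/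
private theorem empiricalEnergyField_one_eq {N : ℕ}
    (z : Literature.Analysis.FluidPDE.Config N (Fin 3) T3) :
    empiricalEnergyField z (fun _ => 1) =
      (N : ℝ)⁻¹ * Literature.Analysis.FluidPDE.configEnergy z := by
  rw [empiricalEnergyField_eq_sum, Literature.Analysis.FluidPDE.configEnergy]
  congr 1
  rw [Finset.mul_sum]
  exact Finset.sum_congr rfl fun i _ => by ring

/-- The total momentum per particle is a measurable function of the configuration. -/
private theorem measurable_empiricalMomentumField_one {N : ℕ} :
    Measurable fun z : Literature.Analysis.FluidPDE.Config N (Fin 3) T3 =>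
      empiricalMomentumField z (fun _ => 1) := by
  have h : (fun z : Literature.Analysis.FluidPDE.Config N (Fin 3) T3 =>
      empiricalMomentumField z (fun _ => 1)) =
      fun z => (N : ℝ)⁻¹ • ∑ i : Fin N, (z i).2 :=
    funext fun z => empiricalMomentumField_one_eq z
  rw [h]
  have hsum : Measurable fun z : Literature.Analysis.FluidPDE.Config N (Fin 3) T3 =>
      ∑ i : Fin N, (z i).2 :=
    Finset.measurable_sum Finset.univ fun i _ => (measurable_pi_apply i).snd
  exact hsum.const_smul ((N : ℝ)⁻¹)

/-- The total kinetic energy per particle is a measurable function of the configuration. -/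
private theorem measurable_empiricalEnergyField_one {N : ℕ} :
    Measurable fun z : Literature.Analysis.FluidPDE.Config N (Fin 3) T3 =>
      empiricalEnergyField z (fun _ => 1) := by
  have h : (fun z : Literature.Analysis.FluidPDE.Config N (Fin 3) T3 =>
      empiricalEnergyField z (fun _ => 1)) =
      fun z => (N : ℝ)⁻¹ * (2⁻¹ * ∑ i : Fin N, ‖(z i).2‖ ^ 2) :=
    funext fun z => empiricalEnergyField_one_eq z
  rw [h]
  refine measurable_const.mul (measurable_const.mul (Finset.measurable_sum _ fun i _ => ?_))
  exact (measurable_pi_apply i).snd.norm.pow_const 2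

/-! ## Conservation of the totals along the flow on the good set -/

/-- On the good set the total momentum per particle is conserved along the hard-sphere flow. -/
private theorem empiricalMomentumField_one_flow {N : ℕ} {ε : ℝ}
    (Φ : Literature.Analysis.FluidPDE.HardSphereFlow
      (Literature.Analysis.FluidPDE.Torus.geometry (Fin 3)) ε N)
    {z : Literature.Analysis.FluidPDE.Config N (Fin 3) T3} (hz : z ∈ Φ.good) (t : ℝ) :
    empiricalMomentumField (Φ.flow t z) (fun _ => 1) = empiricalMomentumField z (fun _ => 1) := by
  rw [empiricalMomentumField_one_eq, empiricalMomentumField_one_eq, Φ.configMomentum_flow hz t]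

/-- On the good set the total kinetic energy per particle is conserved along the hard-sphere
flow. -/
private theorem empiricalEnergyField_one_flow {N : ℕ} {ε : ℝ}
    (Φ : Literature.Analysis.FluidPDE.HardSphereFlow
      (Literature.Analysis.FluidPDE.Torus.geometry (Fin 3)) ε N)
    {z : Literature.Analysis.FluidPDE.Config N (Fin 3) T3} (hz : z ∈ Φ.good) (t : ℝ) :
    empiricalEnergyField (Φ.flow t z) (fun _ => 1) = empiricalEnergyField z (fun _ => 1) := by
  rw [empiricalEnergyField_one_eq, empiricalEnergyField_one_eq, Φ.configEnergy_flow hz t]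

/-! ## The stub -/

/-- Registered stub `stub_conservedTotalsInLaw` of the birth skeleton of the crux `MeanSecondLaw`:
the joint law of (total momentum per particle, total kinetic energy per particle) under the
time-`t` law `(Φ_t)_* P₀` of the local Gibbs law `P₀` equals the joint law under `P₀`
(`= localGibbsMeasure`). Conservation of momentum and energy on the good set, which is conull
for `P₀ ≪ Liouville`. -/
theorem stub_conservedTotalsInLaw :
    ∀ σ : ℝ, 0 < σ →
    ∀ (a₀ θ₀ : T3 → ℝ) (u₀ : T3 → V3), Continuous a₀ → Continuous θ₀ → Continuous u₀ →
      (∀ x, 0 < a₀ x) → (∀ x, 0 < θ₀ x) →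
    ∀ (N : ℕ) (Φ : Literature.Analysis.FluidPDE.HardSphereFlow
        (Literature.Analysis.FluidPDE.Torus.geometry (Fin 3)) (hsDiameter σ N) (N + 1)) (t : ℝ), 0 ≤ t →
    ∀ B : Set (V3 × ℝ), MeasurableSet B →
      ((localGibbsLaw σ a₀ u₀ θ₀ N Φ).map (Φ.flow t))
          {z | (empiricalMomentumField z (fun _ => 1), empiricalEnergyField z (fun _ => 1)) ∈ B} =
        localGibbsMeasure σ a₀ u₀ θ₀ N
          {z | (empiricalMomentumField z (fun _ => 1), empiricalEnergyField z (fun _ => 1)) ∈ B} := by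
  intro σ _hσ a₀ θ₀ u₀ _ha _hθ _hu _ha0 _hθ0 N Φ t _ht B hB
  set S : Set (Literature.Analysis.FluidPDE.Config (N + 1) (Fin 3) T3) :=
    {z | (empiricalMomentumField z (fun _ => 1), empiricalEnergyField z (fun _ => 1)) ∈ B}
    with hS_def
  have hS : MeasurableSet S :=
    (measurable_empiricalMomentumField_one.prodMk measurable_empiricalEnergyField_one) hB
  rw [Measure.map_apply (Φ.measurable_flow t) hS, localGibbsLaw_eq]
  refine measure_congr ?_
  have hgood : ∀ᵐ z ∂localGibbsMeasure σ a₀ u₀ θ₀ N, z ∈ Φ.good :=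
    (localGibbsMeasure_absolutelyContinuous σ a₀ u₀ θ₀ N Φ).ae_le Φ.ae_mem_good
  filter_upwards [hgood] with z hz
  simp only [eq_iff_iff]
  show Φ.flow t z ∈ S ↔ z ∈ S
  rw [hS_def, mem_setOf_eq, mem_setOf_eq, empiricalMomentumField_one_flow Φ hz t,
    empiricalEnergyField_one_flow Φ hz t]

end Summit.AtomisticToContinuum.HydrodynamicLimit.Theorems.MeanSecondLawBirth

end
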